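import Summits.CriticalPhenomena.PercolationContinuityZ3.Theorems.Transplant.FKConnectivityAllQAntipodalOrAttPath
import Summits.CriticalPhenomena.PercolationContinuityZ3.Theorems.Transplant.FKConnectivityAllQAntipodalQfree
import Summits.CriticalPhenomena.PercolationContinuityZ3.Theorems.Transplant.FKConnectivityAllQAntipodalMinorDefs
import HarnessLib

/-!
# Connectivity correlation inequalities for `φ_{w,q}`, every `q > 0` — file 47f: CONJECTURE `C_∞⁺` FOR THE TYPE `x ∧ (y ∨ z)` — every cell,
# every antitone level weight, every 2-connected series–parallel graph (the first of gen 21's two open level-3 inequalities)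

Support file (`--supports stmt-CriticalPhenomena-4575`), FK sub-lane `prim-bschramm-fk-2` (gen 22); builds on p205010 (kernel theorem,
internal audit signed; external expert review pending).  No definitions, no named facts, no sorries; standard axioms.

* `FK.apPsiCW_orAttInd_eq` — the bridge: for `f = 1{x ∈ · ∧ (y ∈ · ∨ z ∈ ·)}` (`x, y, z ∉ N ∪ C` distinct, `g` not reading `x, y, z`) the weighted
  antipodal form of the cell `(N ∪ {x,y,z}, C)` equals `2 · O(N; y, z; C)` with root `x` (the three two-sided drifts of `…OrAttPath`).
* **`FK.apPsiCW_orAtt_nonpos_of_isTTSP`** — `E` TTSP between `s, t`, `st ∉ E` (`H = E ∪ {st}` any 2-connected series–parallel graph presented from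
  the edge `x = st`), `N, C ⊆ E` disjoint, `y ≠ z ∈ E` outside `N ∪ C`, `w` ANTITONE, `g` increasing and not reading `x, y, z` ⟹
  `∑_{γ ⊆ N∪{x,y,z}} w(k(γ∪C)+k(((N∪{x,y,z})\γ)∪C)) (f(γ∪C) − f(…)) (g(γ∪C) − g(…)) ≤ 0`.
* `FK.apPsiC_levels_le_orAtt_nonpos_of_isTTSP` (partial sums by cluster level — every coefficient, in the edge odds AND in `q`, of
  `Z_H(z,q)² Cov_{φ_{z,q}}(1{ω_x ∧ (ω_y ∨ ω_z)}, g)/(q−1)` is `≥ 0`), `FK.apPsiC_orAtt_nonpos_of_levels` (all `0 ≤ q ≤ 1`, Abel bridge of `…Qfree`).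
With `…AntipodalAndPlus(Or)` (AND/OR), `…MinorWeightUpc` (one edge, levelwise Theorem U) and `…Qfree`/`…MinorWeightUpc` (two edges) this leaves
`maj₃` as the only odd type on three edges for which the `q`-free form of `C_∞` is open (memo FROM-fk-2-g22, FK-Q2 §31).
[cite: Grimmett2006, §1.4 eq. (1.20) (p. 15); §3.8 Thm. (3.90) (pp. 61–62); §3.9 (pp. 63–64)] [cite: Wagner2006, Thm. 5.8(d), §5.3]
-/

noncomputable section

namespace Summit.CriticalPhenomena.PercolationContinuityZ3.Theorems

namespace FK

open SimpleGraph Literature.Probability.LatticeModels Literature.Probability.Percolation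
open scoped Classical

variable {V : Type*} [Fintype V]

section OrAttPlus

omit [Fintype V] in
/-- **Half-sum form of the weighted antipodal form of a cell**: by the symmetry `γ ↦ M \ γ` (which preserves the exponent and negates both odd
parts), `∑_γ W(γ) f̂(γ) ĝ(γ) = 2 ∑_γ W(γ) f̂(γ) g(γ ∪ C)`. [cite: Grimmett2006, §1.4 eq. (1.20) (p. 15)] -/
theorem apPsiCW_half_eq (w : ℕ → ℝ) (M C : Finset (Sym2 V)) (F g : Finset (Sym2 V) → ℝ) :
    ∑ γ ∈ M.powerset, w (apExpC M C γ) * ((F (γ ∪ C) - F (M \ γ ∪ C)) * (g (γ ∪ C) - g (M \ γ ∪ C))) =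
      2 * ∑ γ ∈ M.powerset, w (apExpC M C γ) * (F (γ ∪ C) - F (M \ γ ∪ C)) * g (γ ∪ C) := by
  have hsym : ∀ γ ∈ M.powerset, apExpC M C (M \ γ) = apExpC M C γ := by
    intro γ hγ
    rw [Finset.mem_powerset] at hγ
    unfold apExpC
    rw [Finset.sdiff_sdiff_eq_self hγ, add_comm]
  have h2 : ∑ γ ∈ M.powerset, w (apExpC M C γ) * ((F (γ ∪ C) - F (M \ γ ∪ C)) * (g (γ ∪ C) - g (M \ γ ∪ C))) =
      ∑ γ ∈ M.powerset, w (apExpC M C γ) * (F (γ ∪ C) - F (M \ γ ∪ C)) * g (γ ∪ C) -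
        ∑ γ ∈ M.powerset, w (apExpC M C γ) * (F (γ ∪ C) - F (M \ γ ∪ C)) * g (M \ γ ∪ C) := by
    rw [← Finset.sum_sub_distrib]
    exact Finset.sum_congr rfl fun γ _ => by ring
  have h3 : ∑ γ ∈ M.powerset, w (apExpC M C γ) * (F (γ ∪ C) - F (M \ γ ∪ C)) * g (M \ γ ∪ C) =
      -∑ γ ∈ M.powerset, w (apExpC M C γ) * (F (γ ∪ C) - F (M \ γ ∪ C)) * g (γ ∪ C) := by
    rw [sum_powerset_flip M (fun γ => w (apExpC M C γ) * (F (γ ∪ C) - F (M \ γ ∪ C)) * g (M \ γ ∪ C)), ← Finset.sum_neg_distrib]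
    refine Finset.sum_congr rfl fun γ hγ => ?_
    rw [hsym γ hγ]
    rw [Finset.mem_powerset] at hγ
    simp only [Finset.sdiff_sdiff_eq_self hγ]
    ring
  rw [h2, h3]
  ring

omit [Fintype V] in
/-- **Bridge.**  For distinct `x, y, z ∉ N ∪ C` and `g` not reading `x, y, z`, the weighted antipodal form of `f = 1{x ∈ · ∧ (y ∈ · ∨ z ∈ ·)}`
in the cell `(N ∪ {x,y,z}, C)` is twice the sum of the three two-sided drifts `(yzC | C) + (zC | yC) + (yC | zC)` with root `x`.
[cite: Grimmett2006, §1.4 eq. (1.20) (p. 15); §3.8 (pp. 61–62)] -/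
theorem apPsiCW_orAttInd_eq (w : ℕ → ℝ) {N C : Finset (Sym2 V)} {x y z : Sym2 V}
    (hxN : x ∉ N) (hyN : y ∉ N) (hzN : z ∉ N) (hxC : x ∉ C) (hyC : y ∉ C) (hzC : z ∉ C)
    (hxy : x ≠ y) (hxz : x ≠ z) (hyz : y ≠ z)
    {g : Finset (Sym2 V) → ℝ} (hg : ∀ A U : Finset (Sym2 V), U ⊆ ({x, y, z} : Finset (Sym2 V)) → g (A ∪ U) = g A) :
    ∑ γ ∈ (N ∪ {x, y, z}).powerset, w (apExpC (N ∪ {x, y, z}) C γ) *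
        ((((fun X : Finset (Sym2 V) => if x ∈ X ∧ (y ∈ X ∨ z ∈ X) then (1 : ℝ) else 0) (γ ∪ C)) -
            ((fun X : Finset (Sym2 V) => if x ∈ X ∧ (y ∈ X ∨ z ∈ X) then (1 : ℝ) else 0) ((N ∪ {x, y, z}) \ γ ∪ C))) *
          (g (γ ∪ C) - g ((N ∪ {x, y, z}) \ γ ∪ C))) =
      2 * (∑ γ ∈ N.powerset,
          (w (clusterCount (↑(insert x (γ ∪ insert y (insert z C))) : BondConfig V) ∅ +
                clusterCount (↑(N \ γ ∪ C) : BondConfig V) ∅) -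
            w (clusterCount (↑(insert x (N \ γ ∪ insert y (insert z C))) : BondConfig V) ∅ +
                clusterCount (↑(γ ∪ C) : BondConfig V) ∅)) * g (γ ∪ C) +
        ∑ γ ∈ N.powerset,
          (w (clusterCount (↑(insert x (γ ∪ insert z C)) : BondConfig V) ∅ +
                clusterCount (↑(N \ γ ∪ insert y C) : BondConfig V) ∅) -
            w (clusterCount (↑(insert x (N \ γ ∪ insert z C)) : BondConfig V) ∅ +
                clusterCount (↑(γ ∪ insert y C) : BondConfig V) ∅)) * g (γ ∪ C) +
        ∑ γ ∈ N.powerset,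
          (w (clusterCount (↑(insert x (γ ∪ insert y C)) : BondConfig V) ∅ +
                clusterCount (↑(N \ γ ∪ insert z C) : BondConfig V) ∅) -
            w (clusterCount (↑(insert x (N \ γ ∪ insert y C)) : BondConfig V) ∅ +
                clusterCount (↑(γ ∪ insert z C) : BondConfig V) ∅)) * g (γ ∪ C)) := by
  rw [apPsiCW_half_eq w (N ∪ {x, y, z}) C (fun X : Finset (Sym2 V) => if x ∈ X ∧ (y ∈ X ∨ z ∈ X) then (1 : ℝ) else 0) g]
  congr 1
  -- the cell's edge set as an insert-chain over `N`
  have hset : N ∪ {x, y, z} = insert x (insert y (insert z N)) := by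
    rw [Finset.union_comm, Finset.insert_union, Finset.insert_union, Finset.singleton_union]
  rw [hset]
  have hxN' : x ∉ insert y (insert z N) := by
    rw [Finset.mem_insert, Finset.mem_insert, not_or, not_or]; exact ⟨hxy, hxz, hxN⟩
  have hyN' : y ∉ insert z N := by rw [Finset.mem_insert, not_or]; exact ⟨hyz, hyN⟩
  rw [Finset.sum_powerset_insert hxN', Finset.sum_powerset_insert hyN', Finset.sum_powerset_insert hyN',
    Finset.sum_powerset_insert hzN, Finset.sum_powerset_insert hzN, Finset.sum_powerset_insert hzN, Finset.sum_powerset_insert hzN]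
  -- `g` ignores `x, y, z`
  have hgx : ∀ A : Finset (Sym2 V), g (insert x A) = g A := fun A => by
    rw [Finset.insert_eq, Finset.union_comm]; exact hg A {x} (by simp)
  have hgy : ∀ A : Finset (Sym2 V), g (insert y A) = g A := fun A => by
    rw [Finset.insert_eq, Finset.union_comm]; exact hg A {y} (by simp)
  have hgz : ∀ A : Finset (Sym2 V), g (insert z A) = g A := fun A => by
    rw [Finset.insert_eq, Finset.union_comm]; exact hg A {z} (by simp)
  simp only [← Finset.sum_add_distrib]
  refine Finset.sum_congr rfl fun β hβ => ?_
  rw [Finset.mem_powerset] at hβ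
  have hxβ : x ∉ β := fun hh => hxN (hβ hh)
  have hyβ : y ∉ β := fun hh => hyN (hβ hh)
  have hzβ : z ∉ β := fun hh => hzN (hβ hh)
  simp only [apExpC, Finset.insert_sdiff_of_mem, Finset.insert_sdiff_of_notMem, Finset.sdiff_insert_of_notMem, Finset.mem_insert,
    Finset.mem_union, Finset.mem_sdiff, hxβ, hyβ, hzβ, hxN, hyN, hzN, hxC, hyC, hzC, hxy, hxz, hyz, hxy.symm, hxz.symm, hyz.symm,
    Finset.insert_union, Finset.union_insert, hgx, hgy, hgz, or_true, or_false, and_true, and_false,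
    if_true, if_false, not_false_iff, or_self, sub_zero, zero_sub, sub_self, mul_zero, zero_mul, mul_one]
  ring

/-- **THEOREM (Conjecture `C_∞⁺` for the type `x ∧ (y ∨ z)` — every cell, every antitone weight).**  `E` TTSP between `s, t`, `st ∉ E`
(`H = E ∪ {st}` an arbitrary 2-connected series–parallel graph presented from the edge `x = st`), `N, C ⊆ E` disjoint (free / contracted),
`y ≠ z ∈ E` outside `N ∪ C`, `w` antitone, `g` increasing and not reading `x, y, z` ⟹ the weighted antipodal form of
`f = 1{x ∈ · ∧ (y ∈ · ∨ z ∈ ·)}` against `g` in the cell `(N ∪ {x,y,z}, C)` is `≤ 0`.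
[cite: Grimmett2006, §3.8 Thm. (3.90) (pp. 61–62); §3.9 (pp. 63–64)] [cite: Wagner2006, Thm. 5.8(d), §5.3] -/
theorem apPsiCW_orAtt_nonpos_of_isTTSP {E : Finset (Sym2 V)} {s t : V}
    (hE : IsTTSP E s t) (hst : s(s, t) ∉ E) {N C : Finset (Sym2 V)} {y z : Sym2 V} (hN : N ⊆ E) (hC : C ⊆ E)
    (hy : y ∈ E) (hz : z ∈ E) (hyz : y ≠ z) (hyN : y ∉ N) (hzN : z ∉ N) (hyC : y ∉ C) (hzC : z ∉ C) (hNC : Disjoint N C)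
    {w : ℕ → ℝ} (hw : ∀ n : ℕ, w (n + 1) ≤ w n)
    {g : Finset (Sym2 V) → ℝ} (hg : ∀ A U : Finset (Sym2 V), U ⊆ ({s(s, t), y, z} : Finset (Sym2 V)) → g (A ∪ U) = g A)
    (hmono : ∀ ⦃X Y : Finset (Sym2 V)⦄, X ⊆ Y → g X ≤ g Y) :
    ∑ γ ∈ (N ∪ {s(s, t), y, z}).powerset, w (apExpC (N ∪ {s(s, t), y, z}) C γ) *
        ((((fun X : Finset (Sym2 V) => if s(s, t) ∈ X ∧ (y ∈ X ∨ z ∈ X) then (1 : ℝ) else 0) (γ ∪ C)) -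
            ((fun X : Finset (Sym2 V) => if s(s, t) ∈ X ∧ (y ∈ X ∨ z ∈ X) then (1 : ℝ) else 0) ((N ∪ {s(s, t), y, z}) \ γ ∪ C))) *
          (g (γ ∪ C) - g ((N ∪ {s(s, t), y, z}) \ γ ∪ C))) ≤ 0 := by
  have hxN : s(s, t) ∉ N := fun hh => hst (hN hh)
  have hxC : s(s, t) ∉ C := fun hh => hst (hC hh)
  have hxy : s(s, t) ≠ y := fun hh => hst (hh ▸ hy)
  have hxz : s(s, t) ≠ z := fun hh => hst (hh ▸ hz)
  rw [apPsiCW_orAttInd_eq w hxN hyN hzN hxC hyC hzC hxy hxz hyz hg]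
  have main := orAttW_drift_nonpos_of_isTTSP E.card le_rfl hE hst hN hC hy hz hyz hyN hzN hyC hzC hNC w hw (fun γ => g (γ ∪ C))
    (fun X Y hXY _ => hmono (Finset.union_subset_union hXY le_rfl))
  linarith

/-- **COROLLARY (partial sums by cluster level): every coefficient — in the edge odds AND in `q` — of
`Z_H(z,q)² Cov_{φ_{z,q}}(1{ω_x (ω_y ∨ ω_z)}, g)/(q−1)` is nonnegative.**  Under the hypotheses of `FK.apPsiCW_orAtt_nonpos_of_isTTSP` (no weight),
for every level cut-off `J`, the sum of the summands of `apPsiC q (N ∪ {x,y,z}) C f g` of cluster level `≤ J` is `≤ 0`.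
[cite: Grimmett2006, §3.8 Thm. (3.90) (pp. 61–62); §3.9 (pp. 63–64)] [cite: Wagner2006, Thm. 5.8(d), §5.3] -/
theorem apPsiC_levels_le_orAtt_nonpos_of_isTTSP {E : Finset (Sym2 V)} {s t : V}
    (hE : IsTTSP E s t) (hst : s(s, t) ∉ E) {N C : Finset (Sym2 V)} {y z : Sym2 V} (hN : N ⊆ E) (hC : C ⊆ E)
    (hy : y ∈ E) (hz : z ∈ E) (hyz : y ≠ z) (hyN : y ∉ N) (hzN : z ∉ N) (hyC : y ∉ C) (hzC : z ∉ C) (hNC : Disjoint N C) (J : ℕ)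
    {g : Finset (Sym2 V) → ℝ} (hg : ∀ A U : Finset (Sym2 V), U ⊆ ({s(s, t), y, z} : Finset (Sym2 V)) → g (A ∪ U) = g A)
    (hmono : ∀ ⦃X Y : Finset (Sym2 V)⦄, X ⊆ Y → g X ≤ g Y) :
    ∑ γ ∈ (N ∪ {s(s, t), y, z}).powerset with apExpC (N ∪ {s(s, t), y, z}) C γ ≤ J,
        ((((fun X : Finset (Sym2 V) => if s(s, t) ∈ X ∧ (y ∈ X ∨ z ∈ X) then (1 : ℝ) else 0) (γ ∪ C)) -
            ((fun X : Finset (Sym2 V) => if s(s, t) ∈ X ∧ (y ∈ X ∨ z ∈ X) then (1 : ℝ) else 0) ((N ∪ {s(s, t), y, z}) \ γ ∪ C))) *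
          (g (γ ∪ C) - g ((N ∪ {s(s, t), y, z}) \ γ ∪ C))) ≤ 0 := by
  have key := apPsiCW_orAtt_nonpos_of_isTTSP hE hst hN hC hy hz hyz hyN hzN hyC hzC hNC (w := fun n => if n ≤ J then (1 : ℝ) else 0)
    (fun n => by
      split_ifs with h1 h2 h2
      · exact le_rfl
      · exact absurd ((Nat.le_succ n).trans h1) h2
      · exact zero_le_one
      · exact le_rfl) hg hmono
  rw [Finset.sum_filter]
  refine le_of_eq_of_le (Finset.sum_congr rfl fun γ _ => ?_) key
  split_ifs <;> ring

/-- **COROLLARY (the type `x ∧ (y ∨ z)` of Conjecture `C_∞` for all `0 ≤ q ≤ 1`, every cell, via the Abel bridge of `…Qfree`).**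
[cite: Grimmett2006, §3.8 Thm. (3.90) (pp. 61–62); §3.9 (pp. 63–64)] [cite: Wagner2006, Thm. 5.8(d), §5.3] -/
theorem apPsiC_orAtt_nonpos_of_levels {q : ℝ} (hq0 : 0 ≤ q) (hq1 : q ≤ 1) {E : Finset (Sym2 V)} {s t : V}
    (hE : IsTTSP E s t) (hst : s(s, t) ∉ E) {N C : Finset (Sym2 V)} {y z : Sym2 V} (hN : N ⊆ E) (hC : C ⊆ E)
    (hy : y ∈ E) (hz : z ∈ E) (hyz : y ≠ z) (hyN : y ∉ N) (hzN : z ∉ N) (hyC : y ∉ C) (hzC : z ∉ C) (hNC : Disjoint N C)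
    {g : Finset (Sym2 V) → ℝ} (hg : ∀ A U : Finset (Sym2 V), U ⊆ ({s(s, t), y, z} : Finset (Sym2 V)) → g (A ∪ U) = g A)
    (hmono : ∀ ⦃X Y : Finset (Sym2 V)⦄, X ⊆ Y → g X ≤ g Y) :
    apPsiC q (N ∪ {s(s, t), y, z}) C (fun X => if s(s, t) ∈ X ∧ (y ∈ X ∨ z ∈ X) then 1 else 0) g ≤ 0 :=
  sum_pow_mul_nonpos_of_levels_le (N ∪ {s(s, t), y, z}).powerset (apExpC (N ∪ {s(s, t), y, z}) C)
    (fun γ => (((fun X : Finset (Sym2 V) => if s(s, t) ∈ X ∧ (y ∈ X ∨ z ∈ X) then (1 : ℝ) else 0) (γ ∪ C)) -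
      ((fun X : Finset (Sym2 V) => if s(s, t) ∈ X ∧ (y ∈ X ∨ z ∈ X) then (1 : ℝ) else 0) ((N ∪ {s(s, t), y, z}) \ γ ∪ C))) *
      (g (γ ∪ C) - g ((N ∪ {s(s, t), y, z}) \ γ ∪ C)))
    hq0 hq1 fun J => apPsiC_levels_le_orAtt_nonpos_of_isTTSP hE hst hN hC hy hz hyz hyN hzN hyC hzC hNC J hg hmono

omit [Fintype V] in
/-- The dual type `x ∨ (y ∧ z)` has the same odd part as `x ∧ (y ∨ z)` on complementary pairs of a cell. [folklore] -/
theorem orDual_odd_eq {M C γ : Finset (Sym2 V)} {x y z : Sym2 V} (hxC : x ∉ C) (hyC : y ∉ C) (hzC : z ∉ C)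
    (hx : x ∈ M) (hy : y ∈ M) (hz : z ∈ M) :
    ((fun X : Finset (Sym2 V) => if x ∈ X ∨ (y ∈ X ∧ z ∈ X) then (1 : ℝ) else 0) (γ ∪ C)) -
        ((fun X : Finset (Sym2 V) => if x ∈ X ∨ (y ∈ X ∧ z ∈ X) then (1 : ℝ) else 0) (M \ γ ∪ C)) =
      ((fun X : Finset (Sym2 V) => if x ∈ X ∧ (y ∈ X ∨ z ∈ X) then (1 : ℝ) else 0) (γ ∪ C)) -
        ((fun X : Finset (Sym2 V) => if x ∈ X ∧ (y ∈ X ∨ z ∈ X) then (1 : ℝ) else 0) (M \ γ ∪ C)) := by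
  have ex : x ∈ γ ∪ C ↔ x ∈ γ := by rw [Finset.mem_union, or_iff_left hxC]
  have ey : y ∈ γ ∪ C ↔ y ∈ γ := by rw [Finset.mem_union, or_iff_left hyC]
  have ez : z ∈ γ ∪ C ↔ z ∈ γ := by rw [Finset.mem_union, or_iff_left hzC]
  have ex' : x ∈ M \ γ ∪ C ↔ x ∉ γ := by rw [Finset.mem_union, or_iff_left hxC, Finset.mem_sdiff, and_iff_right hx]
  have ey' : y ∈ M \ γ ∪ C ↔ y ∉ γ := by rw [Finset.mem_union, or_iff_left hyC, Finset.mem_sdiff, and_iff_right hy]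
  have ez' : z ∈ M \ γ ∪ C ↔ z ∉ γ := by rw [Finset.mem_union, or_iff_left hzC, Finset.mem_sdiff, and_iff_right hz]
  simp only [ex, ey, ez, ex', ey', ez']
  by_cases a : x ∈ γ <;> by_cases b : y ∈ γ <;> by_cases c : z ∈ γ <;> simp [a, b, c]

/-- **THEOREM (Conjecture `C_∞⁺` for the dual type `x ∨ (y ∧ z)` — every cell, every antitone weight)**: same odd part as `x ∧ (y ∨ z)`.
[cite: Grimmett2006, §3.8 Thm. (3.90) (pp. 61–62); §3.9 (pp. 63–64)] [cite: Wagner2006, Thm. 5.8(d), §5.3] -/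
theorem apPsiCW_orDual_nonpos_of_isTTSP {E : Finset (Sym2 V)} {s t : V}
    (hE : IsTTSP E s t) (hst : s(s, t) ∉ E) {N C : Finset (Sym2 V)} {y z : Sym2 V} (hN : N ⊆ E) (hC : C ⊆ E)
    (hy : y ∈ E) (hz : z ∈ E) (hyz : y ≠ z) (hyN : y ∉ N) (hzN : z ∉ N) (hyC : y ∉ C) (hzC : z ∉ C) (hNC : Disjoint N C)
    {w : ℕ → ℝ} (hw : ∀ n : ℕ, w (n + 1) ≤ w n)
    {g : Finset (Sym2 V) → ℝ} (hg : ∀ A U : Finset (Sym2 V), U ⊆ ({s(s, t), y, z} : Finset (Sym2 V)) → g (A ∪ U) = g A)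
    (hmono : ∀ ⦃X Y : Finset (Sym2 V)⦄, X ⊆ Y → g X ≤ g Y) :
    ∑ γ ∈ (N ∪ {s(s, t), y, z}).powerset, w (apExpC (N ∪ {s(s, t), y, z}) C γ) *
        ((((fun X : Finset (Sym2 V) => if s(s, t) ∈ X ∨ (y ∈ X ∧ z ∈ X) then (1 : ℝ) else 0) (γ ∪ C)) -
            ((fun X : Finset (Sym2 V) => if s(s, t) ∈ X ∨ (y ∈ X ∧ z ∈ X) then (1 : ℝ) else 0) ((N ∪ {s(s, t), y, z}) \ γ ∪ C))) *
          (g (γ ∪ C) - g ((N ∪ {s(s, t), y, z}) \ γ ∪ C))) ≤ 0 := by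
  have hxC : s(s, t) ∉ C := fun hh => hst (hC hh)
  have hxM : s(s, t) ∈ N ∪ {s(s, t), y, z} := Finset.mem_union_right _ (by simp)
  have hyM : y ∈ N ∪ {s(s, t), y, z} := Finset.mem_union_right _ (by simp)
  have hzM : z ∈ N ∪ {s(s, t), y, z} := Finset.mem_union_right _ (by simp)
  rw [Finset.sum_congr rfl fun γ _ => by rw [orDual_odd_eq hxC hyC hzC hxM hyM hzM]]
  exact apPsiCW_orAtt_nonpos_of_isTTSP hE hst hN hC hy hz hyz hyN hzN hyC hzC hNC hw hg hmono

/-- **COROLLARY (dual type, partial sums by cluster level).** [cite: Grimmett2006, §3.8 Thm. (3.90) (pp. 61–62)] [cite: Wagner2006, Thm. 5.8(d), §5.3] -/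
theorem apPsiC_levels_le_orDual_nonpos_of_isTTSP {E : Finset (Sym2 V)} {s t : V}
    (hE : IsTTSP E s t) (hst : s(s, t) ∉ E) {N C : Finset (Sym2 V)} {y z : Sym2 V} (hN : N ⊆ E) (hC : C ⊆ E)
    (hy : y ∈ E) (hz : z ∈ E) (hyz : y ≠ z) (hyN : y ∉ N) (hzN : z ∉ N) (hyC : y ∉ C) (hzC : z ∉ C) (hNC : Disjoint N C) (J : ℕ)
    {g : Finset (Sym2 V) → ℝ} (hg : ∀ A U : Finset (Sym2 V), U ⊆ ({s(s, t), y, z} : Finset (Sym2 V)) → g (A ∪ U) = g A)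
    (hmono : ∀ ⦃X Y : Finset (Sym2 V)⦄, X ⊆ Y → g X ≤ g Y) :
    ∑ γ ∈ (N ∪ {s(s, t), y, z}).powerset with apExpC (N ∪ {s(s, t), y, z}) C γ ≤ J,
        ((((fun X : Finset (Sym2 V) => if s(s, t) ∈ X ∨ (y ∈ X ∧ z ∈ X) then (1 : ℝ) else 0) (γ ∪ C)) -
            ((fun X : Finset (Sym2 V) => if s(s, t) ∈ X ∨ (y ∈ X ∧ z ∈ X) then (1 : ℝ) else 0) ((N ∪ {s(s, t), y, z}) \ γ ∪ C))) *
          (g (γ ∪ C) - g ((N ∪ {s(s, t), y, z}) \ γ ∪ C))) ≤ 0 := by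
  have key := apPsiCW_orDual_nonpos_of_isTTSP hE hst hN hC hy hz hyz hyN hzN hyC hzC hNC (w := fun n => if n ≤ J then (1 : ℝ) else 0)
    (fun n => by
      split_ifs with h1 h2 h2
      · exact le_rfl
      · exact absurd ((Nat.le_succ n).trans h1) h2
      · exact zero_le_one
      · exact le_rfl) hg hmono
  rw [Finset.sum_filter]
  refine le_of_eq_of_le (Finset.sum_congr rfl fun γ _ => ?_) key
  split_ifs <;> ring

/-- **COROLLARY (the dual type `x ∨ (y ∧ z)` for all `0 ≤ q ≤ 1`, every cell).**
[cite: Grimmett2006, §3.8 Thm. (3.90) (pp. 61–62); §3.9 (pp. 63–64)] [cite: Wagner2006, Thm. 5.8(d), §5.3] -/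
theorem apPsiC_orDual_nonpos_of_levels {q : ℝ} (hq0 : 0 ≤ q) (hq1 : q ≤ 1) {E : Finset (Sym2 V)} {s t : V}
    (hE : IsTTSP E s t) (hst : s(s, t) ∉ E) {N C : Finset (Sym2 V)} {y z : Sym2 V} (hN : N ⊆ E) (hC : C ⊆ E)
    (hy : y ∈ E) (hz : z ∈ E) (hyz : y ≠ z) (hyN : y ∉ N) (hzN : z ∉ N) (hyC : y ∉ C) (hzC : z ∉ C) (hNC : Disjoint N C)
    {g : Finset (Sym2 V) → ℝ} (hg : ∀ A U : Finset (Sym2 V), U ⊆ ({s(s, t), y, z} : Finset (Sym2 V)) → g (A ∪ U) = g A)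
    (hmono : ∀ ⦃X Y : Finset (Sym2 V)⦄, X ⊆ Y → g X ≤ g Y) :
    apPsiC q (N ∪ {s(s, t), y, z}) C (fun X => if s(s, t) ∈ X ∨ (y ∈ X ∧ z ∈ X) then 1 else 0) g ≤ 0 :=
  sum_pow_mul_nonpos_of_levels_le (N ∪ {s(s, t), y, z}).powerset (apExpC (N ∪ {s(s, t), y, z}) C)
    (fun γ => (((fun X : Finset (Sym2 V) => if s(s, t) ∈ X ∨ (y ∈ X ∧ z ∈ X) then (1 : ℝ) else 0) (γ ∪ C)) -
      ((fun X : Finset (Sym2 V) => if s(s, t) ∈ X ∨ (y ∈ X ∧ z ∈ X) then (1 : ℝ) else 0) ((N ∪ {s(s, t), y, z}) \ γ ∪ C))) *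
      (g (γ ∪ C) - g ((N ∪ {s(s, t), y, z}) \ γ ∪ C)))
    hq0 hq1 fun J => apPsiC_levels_le_orDual_nonpos_of_isTTSP hE hst hN hC hy hz hyz hyN hzN hyC hzC hNC J hg hmono

end OrAttPlus

end FK

end Summit.CriticalPhenomena.PercolationContinuityZ3.Theorems

end
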